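import Summits.Ventures.Crystal3D.Theorems.StickyWulffConstantGenericWallFloorSlotDozensCubic
import Summits.Ventures.Crystal3D.Theorems.StickyWulffConstantGenericWallFloorDozenRigidity
import Summits.Ventures.Crystal3D.Theorems.StickyWulffConstantPolycrystalWulffBoundSingleGrain
import HarnessLib

/-!
# Dozen rigidity, pattern form: a close-packed dozen sharing three independent slots with a grain is
# the grain's slot dozen (fcc type) or one of its eight twins (hcp type)
# (crux `GenericWallFloor`, line `WallLedgerG`; E2 single-dozen algebra)

HONEST FRAMING. Part of the venture `Summits/Ventures/Crystal3D` (cell `crystal3d-full`), helper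
`--supports` the crux `GenericWallFloor` (stmt-Ventures-19480) of `route-Ventures-StickyWulffConstant`,
registered line `WallLedgerG` (planner cf-p1 gen 16/22), open stub `stub_twoSlabAdhesion` — general-filling
step, per-ball programme E2 (cf-p1 ROUTE.md §80(6)–(9): maximal exact continuation + «single-dozen
algebra»; 19480-p1's planned finite lemma «arranged dozen ⊇ cubo vertex figure ⇒ cubo or twin cap»).

SETTING. `A : ℝ³ ≃ₗᵢ ℝ³` a grain frame (slots `A w`, `w ∈ fccSlots`); `B : ℝ³ →ₗᵢ ℝ³` the frame of a
close-packed dozen `B(fccKissingPattern)` / `B(hcpKissingPattern)` — the output currency of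
`exists_frame_of_allButOne` (…SaturationStructure) and of `IsClosePackedDozenAt` (…ExactOnly, E2).

* **`fccDozen_eq_slots_of_three_independent`** — if `B(fccKissingPattern)` contains three LINEARLY
  INDEPENDENT slots of `A`, then `B(fccKissingPattern) = A(fccSlots)`.
* **`hcpDozen_twin_of_three_independent`** — if `B(hcpKissingPattern)` contains three linearly
  independent slots of `A`, then for a unit normal `n` of a `{111}` plane of the grain
  (`⟪A w, n⟫ ∈ {0, ±√(2/3)}` for all slots) the dozen is the TWIN DOZEN
  `{A w : ⟪A w, n⟫ ≤ 0} ∪ {A w − 2⟪A w, n⟫ n : ⟪A w, n⟫ < 0}` — the currency of `exit_twinCap_of_patch`;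
  `slot_mem_twinDozen_iff`: its own part is exactly the nine slots with `⟪A w, n⟫ ≤ 0`
  («hexagon + one polar triple»).
* `hcpDozen_eq_twin_of_fccDozen_eq` — the twin description from `B(fccKissingPattern) = A(fccSlots)`;
  `exists_frame_of_fccDozen` — every isometric fcc dozen is the unit shell of a rigid fcc lattice.

So NO `|O| ≥ 7` / `k₀` threshold is needed for single-dozen-ness: an own pattern that is not coplanar
(coplanar slot sets lie in one hexagon, ≤ 6, or one square, ≤ 4) pins the dozen up to the eight twins, and
`SingleDozen` holds iff moreover the pattern is inside none of the eight nine-sets.  Exact enumeration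
(seat folder calc/dozens2.py) agrees: the only isometric fcc/hcp dozens sharing a non-coplanar triple
with the cuboctahedron are itself and the 8 twins.

Proof: lattice form `movedFcc_eq_of_three_independent_units` (…DozenRigidity) after realising
`B(fccKissingPattern)` as the unit shell of a rigid lattice (`exists_linearIsometryEquiv_unitShell_eq`,
…PolycrystalWulffBoundSingleGrain); for the hcp type, the cubic-frame decomposition
«anticuboctahedron = cuboctahedron twinned across `(111)`» and the MENU TRICK of …SlotDozensCubic
(an upper fcc vector and a twinned upper vector meet at `⟪·,·⟫ ∈ {−1/3, −5/6}`, never a slot angle), so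
the three shared slots lie in ONE of the two fcc dozens `B(fccKP)`, `B(R·fccKP)` of the bicrystal dozen.

WHAT THIS IS NOT: no packing / saturation statement (that is E1 + `unsaturated_of_exactOnly`); not the
stub; rung F-C1 not moved.
-/

noncomputable section

namespace Summit.Ventures.Crystal3D.Theorems

open Literature.Geometry.DiscreteGeometry
open Literature.MathematicalPhysics.StatisticalMechanics (fccStacking)
open scoped InnerProductSpace

/-- The slot dozen of `Λ₀` as a set: `↑fccSlots = {w ∈ Λ₀ | ‖w‖ = 1}`. -/
theorem coe_fccSlots_eq_units :
    (↑fccSlots : Set (EuclideanSpace ℝ (Fin 3))) =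
      {w | w ∈ fccStacking 1 (Real.sqrt (2 / 3)) ∧ ‖w‖ = 1} := by
  ext w
  exact ⟨fun hw => ⟨mem_fcc_of_mem_fccSlots hw, norm_eq_one_of_mem_fccSlots hw⟩,
    fun hw => mem_fccSlots_of_unit hw.1 hw.2⟩

/-- Unit vectors of a moved lattice are the moved unit vectors. -/
theorem units_image_eq (M : EuclideanSpace ℝ (Fin 3) ≃ₗᵢ[ℝ] EuclideanSpace ℝ (Fin 3)) :
    {x | x ∈ M '' fccStacking 1 (Real.sqrt (2 / 3)) ∧ ‖x‖ = 1} =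
      M '' {w | w ∈ fccStacking 1 (Real.sqrt (2 / 3)) ∧ ‖w‖ = 1} := by
  ext x
  constructor
  · rintro ⟨⟨w, hw, rfl⟩, hx⟩
    exact ⟨w, ⟨hw, by rwa [LinearIsometryEquiv.norm_map] at hx⟩, rfl⟩
  · rintro ⟨w, ⟨hw, hn⟩, rfl⟩
    exact ⟨⟨w, hw, rfl⟩, by rw [LinearIsometryEquiv.norm_map, hn]⟩

/-- The moved slot dozen is the unit shell of the moved lattice. -/
theorem image_fccSlots_eq_units (A : EuclideanSpace ℝ (Fin 3) ≃ₗᵢ[ℝ] EuclideanSpace ℝ (Fin 3)) :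
    A '' (↑fccSlots : Set (EuclideanSpace ℝ (Fin 3))) =
      {x | x ∈ A '' fccStacking 1 (Real.sqrt (2 / 3)) ∧ ‖x‖ = 1} := by
  rw [units_image_eq, coe_fccSlots_eq_units]

/-- **Every isometric fcc dozen is the slot dozen of a rigid fcc lattice**: for a linear isometry `B`
there is a frame `A₂` with `B(fccKissingPattern) = ` the unit vectors of `A₂·Λ₀`. -/
theorem exists_frame_of_fccDozen (B : EuclideanSpace ℝ (Fin 3) →ₗᵢ[ℝ] EuclideanSpace ℝ (Fin 3)) :
    ∃ A₂ : EuclideanSpace ℝ (Fin 3) ≃ₗᵢ[ℝ] EuclideanSpace ℝ (Fin 3),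
      B '' (↑fccKissingPattern : Set (EuclideanSpace ℝ (Fin 3))) =
        {x | x ∈ A₂ '' fccStacking 1 (Real.sqrt (2 / 3)) ∧ ‖x‖ = 1} := by
  obtain ⟨L₀, hL₀⟩ := exists_linearIsometryEquiv_unitShell_eq
  let Bh : EuclideanSpace ℝ (Fin 3) ≃ₗᵢ[ℝ] EuclideanSpace ℝ (Fin 3) := B.toLinearIsometryEquiv rfl
  refine ⟨L₀.symm.trans Bh, ?_⟩
  rw [units_image_eq, hL₀, Set.image_image]
  refine Set.image_congr fun p _ => ?_
  simp [Bh]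

/-- **DOZEN RIGIDITY, fcc type (pattern form).**  An isometric image of the cuboctahedron
`fccKissingPattern` containing three LINEARLY INDEPENDENT slots `A w` of a grain `A·Λ₀` is the grain's
slot dozen `A(fccSlots)`. -/
theorem fccDozen_eq_slots_of_three_independent
    (A : EuclideanSpace ℝ (Fin 3) ≃ₗᵢ[ℝ] EuclideanSpace ℝ (Fin 3))
    (B : EuclideanSpace ℝ (Fin 3) →ₗᵢ[ℝ] EuclideanSpace ℝ (Fin 3)) {a b c : EuclideanSpace ℝ (Fin 3)}
    (haB : a ∈ B '' (↑fccKissingPattern : Set (EuclideanSpace ℝ (Fin 3))))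
    (hbB : b ∈ B '' (↑fccKissingPattern : Set (EuclideanSpace ℝ (Fin 3))))
    (hcB : c ∈ B '' (↑fccKissingPattern : Set (EuclideanSpace ℝ (Fin 3))))
    (haA : a ∈ A '' (↑fccSlots : Set (EuclideanSpace ℝ (Fin 3))))
    (hbA : b ∈ A '' (↑fccSlots : Set (EuclideanSpace ℝ (Fin 3))))
    (hcA : c ∈ A '' (↑fccSlots : Set (EuclideanSpace ℝ (Fin 3))))
    (hind : LinearIndependent ℝ ![a, b, c]) :
    B '' (↑fccKissingPattern : Set (EuclideanSpace ℝ (Fin 3))) =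
      A '' (↑fccSlots : Set (EuclideanSpace ℝ (Fin 3))) := by
  obtain ⟨A₂, hA₂⟩ := exists_frame_of_fccDozen B
  rw [hA₂] at haB hbB hcB
  rw [image_fccSlots_eq_units] at haA hbA hcA
  have h := movedFcc_eq_of_three_independent_units A A₂ haA.1 hbA.1 hcA.1 haB.1 hbB.1 hcB.1
    haA.2 hbA.2 hcA.2 hind
  rw [hA₂, image_fccSlots_eq_units, h]

/-- Value bookkeeping: `(√3)⁻¹·√2 = √(2/3)`. -/
theorem sqrt3_inv_mul_sqrt2 : (Real.sqrt 3)⁻¹ * Real.sqrt 2 = Real.sqrt (2 / 3) := by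
  rw [Real.sqrt_div (by norm_num : (0:ℝ) ≤ 2), div_eq_inv_mul]

/-- **The twin dozen from slot equality.**  If the fcc dozen of `B` IS the slot dozen of the grain `A`,
then the hcp dozen of `B` is the TWIN of the slot dozen across the `{111}` plane with unit normal
`n = −B(1,1,1)/√3`: `⟪A w, n⟫ ∈ {0, ±√(2/3)}` for every slot, the nine slots with `⟪A w, n⟫ ≤ 0` are in
the dozen, and the three slots with `⟪A w, n⟫ < 0` contribute their mirror images `A w − 2⟪A w, n⟫ n`
(the currency of `exit_twinCap_of_patch`). -/
theorem hcpDozen_eq_twin_of_fccDozen_eq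
    (A : EuclideanSpace ℝ (Fin 3) ≃ₗᵢ[ℝ] EuclideanSpace ℝ (Fin 3))
    (B : EuclideanSpace ℝ (Fin 3) →ₗᵢ[ℝ] EuclideanSpace ℝ (Fin 3))
    (h : B '' (↑fccKissingPattern : Set (EuclideanSpace ℝ (Fin 3))) =
      A '' (↑fccSlots : Set (EuclideanSpace ℝ (Fin 3)))) :
    ∃ n : EuclideanSpace ℝ (Fin 3), ‖n‖ = 1 ∧
      (∀ w ∈ fccSlots, ⟪A w, n⟫_ℝ = 0 ∨ ⟪A w, n⟫_ℝ = Real.sqrt (2 / 3) ∨ ⟪A w, n⟫_ℝ = -Real.sqrt (2 / 3)) ∧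
      B '' (↑hcpKissingPattern : Set (EuclideanSpace ℝ (Fin 3))) =
        (fun w => A w) '' {w | w ∈ fccSlots ∧ ⟪A w, n⟫_ℝ ≤ 0} ∪
          (fun w => A w - (2 * ⟪A w, n⟫_ℝ) • n) '' {w | w ∈ fccSlots ∧ ⟪A w, n⟫_ℝ < 0} := by
  set d : EuclideanSpace ℝ (Fin 3) := intVec ![1, 1, 1] with hd
  have h3 : (0 : ℝ) < Real.sqrt 3 := Real.sqrt_pos.2 (by norm_num)
  have hdn : ‖d‖ = Real.sqrt 3 := by
    rw [← Real.sqrt_sq (norm_nonneg d), norm_diag_sq]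
  set n : EuclideanSpace ℝ (Fin 3) := -((Real.sqrt 3)⁻¹ • B d) with hn
  have hn1 : ‖n‖ = 1 := by
    rw [hn, norm_neg, norm_smul, norm_inv, Real.norm_of_nonneg h3.le, LinearIsometry.norm_map, hdn,
      inv_mul_cancel₀ h3.ne']
  -- the key relation `⟪B p, n⟫ = −(p₀+p₁+p₂)/√3`
  have key : ∀ p : EuclideanSpace ℝ (Fin 3), ⟪B p, n⟫_ℝ = -((Real.sqrt 3)⁻¹ * (p 0 + p 1 + p 2)) := by
    intro p
    rw [hn, inner_neg_right, real_inner_smul_right, LinearIsometry.inner_map_map, real_inner_comm,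
      inner_diag]
  -- the mirror identity `B p − 2⟪B p, n⟫ n = B (R p)`
  have mirror : ∀ p : EuclideanSpace ℝ (Fin 3),
      B p - (2 * ⟪B p, n⟫_ℝ) • n = B ((ℝ ∙ d)ᗮ.reflection p) := by
    intro p
    rw [twinRefl_apply, map_sub, B.map_smul, key, hn, smul_neg, smul_smul]
    have e : 2 * -((Real.sqrt 3)⁻¹ * (p 0 + p 1 + p 2)) * (Real.sqrt 3)⁻¹ =
        -(2 / 3 * (p 0 + p 1 + p 2)) := by
      have : (Real.sqrt 3)⁻¹ * (Real.sqrt 3)⁻¹ = 1 / 3 := by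
        rw [← mul_inv, Real.mul_self_sqrt (by norm_num : (0:ℝ) ≤ 3)]; norm_num
      linear_combination (-2 * (p 0 + p 1 + p 2)) * this
    rw [e, neg_smul, sub_neg_eq_add, ← sub_eq_add_neg]
  -- slots ↔ pattern vectors
  have toP : ∀ w ∈ fccSlots, ∃ p ∈ fccKissingPattern, B p = A w := by
    intro w hw
    have : A w ∈ B '' (↑fccKissingPattern : Set (EuclideanSpace ℝ (Fin 3))) := by
      rw [h]; exact ⟨w, hw, rfl⟩
    obtain ⟨p, hp, hpw⟩ := this
    exact ⟨p, hp, hpw⟩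
  have toW : ∀ p ∈ fccKissingPattern, ∃ w ∈ fccSlots, A w = B p := by
    intro p hp
    have : B p ∈ A '' (↑fccSlots : Set (EuclideanSpace ℝ (Fin 3))) := by
      rw [← h]; exact ⟨p, hp, rfl⟩
    obtain ⟨w, hw, hwp⟩ := this
    exact ⟨w, hw, hwp⟩
  refine ⟨n, hn1, ?_, ?_⟩
  · intro w hw
    obtain ⟨p, hp, hpw⟩ := toP w hw
    rw [← hpw, key]
    rcases sum_coord_of_mem_fcc hp with hs | hs | hs
    · left; rw [hs]; simp
    · right; right; rw [hs, sqrt3_inv_mul_sqrt2]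
    · right; left; rw [hs, mul_neg, neg_neg, sqrt3_inv_mul_sqrt2]
  · ext x
    constructor
    · rintro ⟨q, hq, rfl⟩
      rcases mem_hcp_cases hq with ⟨hqf, hs⟩ | ⟨p, hp, hs, rfl⟩
      · obtain ⟨w, hw, hwq⟩ := toW q hqf
        refine Or.inl ⟨w, ⟨hw, ?_⟩, hwq⟩
        rw [hwq, key, neg_nonpos]
        exact mul_nonneg (inv_nonneg.2 h3.le) hs
      · obtain ⟨w, hw, hwp⟩ := toW p hp
        refine Or.inr ⟨w, ⟨hw, ?_⟩, ?_⟩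
        · rw [hwp, key, neg_lt_zero]
          exact mul_pos (inv_pos.2 h3) hs
        · show A w - (2 * ⟪A w, n⟫_ℝ) • n = B _
          rw [hwp, mirror]
    · rintro (⟨w, ⟨hw, hle⟩, rfl⟩ | ⟨w, ⟨hw, hlt⟩, rfl⟩)
      · obtain ⟨p, hp, hpw⟩ := toP w hw
        rw [← hpw, key, neg_nonpos] at hle
        have hs : 0 ≤ p 0 + p 1 + p 2 := (mul_nonneg_iff_of_pos_left (inv_pos.2 h3)).1 hle
        exact ⟨p, mem_hcp_of_mem_fcc_of_nonneg hp hs, hpw⟩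
      · obtain ⟨p, hp, hpw⟩ := toP w hw
        rw [← hpw, key, neg_lt_zero] at hlt
        have hs : 0 < p 0 + p 1 + p 2 := (mul_pos_iff_of_pos_left (inv_pos.2 h3)).1 hlt
        refine ⟨_, twinRefl_mem_hcp_of_mem_fcc_of_pos hp hs, ?_⟩
        show B _ = A w - (2 * ⟪A w, n⟫_ℝ) • n
        rw [← hpw, mirror]

/-- **DOZEN RIGIDITY, hcp type (pattern form).**  An isometric image of the anticuboctahedron
`hcpKissingPattern` containing three LINEARLY INDEPENDENT slots of a grain `A·Λ₀` is one of the grain's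
EIGHT TWIN DOZENS: for a unit normal `n` of a `{111}` plane of the grain (`⟪A w, n⟫ ∈ {0, ±√(2/3)}` for all
slots), it consists of the nine slots `A w` with `⟪A w, n⟫ ≤ 0` and the mirror images `A w − 2⟪A w, n⟫ n`
of the three slots with `⟪A w, n⟫ < 0` — the currency of `exit_twinCap_of_patch`.  In particular the own
part (the slots of `A` in the dozen) is exactly «hexagon + one polar triple». -/
theorem hcpDozen_twin_of_three_independent
    (A : EuclideanSpace ℝ (Fin 3) ≃ₗᵢ[ℝ] EuclideanSpace ℝ (Fin 3))
    (B : EuclideanSpace ℝ (Fin 3) →ₗᵢ[ℝ] EuclideanSpace ℝ (Fin 3)) {a b c : EuclideanSpace ℝ (Fin 3)}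
    (haB : a ∈ B '' (↑hcpKissingPattern : Set (EuclideanSpace ℝ (Fin 3))))
    (hbB : b ∈ B '' (↑hcpKissingPattern : Set (EuclideanSpace ℝ (Fin 3))))
    (hcB : c ∈ B '' (↑hcpKissingPattern : Set (EuclideanSpace ℝ (Fin 3))))
    (haA : a ∈ A '' (↑fccSlots : Set (EuclideanSpace ℝ (Fin 3))))
    (hbA : b ∈ A '' (↑fccSlots : Set (EuclideanSpace ℝ (Fin 3))))
    (hcA : c ∈ A '' (↑fccSlots : Set (EuclideanSpace ℝ (Fin 3))))
    (hind : LinearIndependent ℝ ![a, b, c]) :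
    ∃ n : EuclideanSpace ℝ (Fin 3), ‖n‖ = 1 ∧
      (∀ w ∈ fccSlots, ⟪A w, n⟫_ℝ = 0 ∨ ⟪A w, n⟫_ℝ = Real.sqrt (2 / 3) ∨ ⟪A w, n⟫_ℝ = -Real.sqrt (2 / 3)) ∧
      B '' (↑hcpKissingPattern : Set (EuclideanSpace ℝ (Fin 3))) =
        (fun w => A w) '' {w | w ∈ fccSlots ∧ ⟪A w, n⟫_ℝ ≤ 0} ∪
          (fun w => A w - (2 * ⟪A w, n⟫_ℝ) • n) '' {w | w ∈ fccSlots ∧ ⟪A w, n⟫_ℝ < 0} := by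
  let R : EuclideanSpace ℝ (Fin 3) ≃ₗᵢ[ℝ] EuclideanSpace ℝ (Fin 3) :=
    (ℝ ∙ (intVec ![1, 1, 1] : EuclideanSpace ℝ (Fin 3)))ᗮ.reflection
  let B' : EuclideanSpace ℝ (Fin 3) →ₗᵢ[ℝ] EuclideanSpace ℝ (Fin 3) := B.comp R.toLinearIsometry
  have hB' : ∀ p, B' p = B (R p) := fun p => rfl
  -- slots of ONE grain meet at slot angles only
  have menu : ∀ x y : EuclideanSpace ℝ (Fin 3), x ∈ A '' (↑fccSlots : Set (EuclideanSpace ℝ (Fin 3))) →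
      y ∈ A '' (↑fccSlots : Set (EuclideanSpace ℝ (Fin 3))) →
      ⟪x, y⟫_ℝ = 1 ∨ ⟪x, y⟫_ℝ = 1 / 2 ∨ ⟪x, y⟫_ℝ = 0 ∨ ⟪x, y⟫_ℝ = -(1 / 2) ∨ ⟪x, y⟫_ℝ = -1 := by
    intro x y hx hy
    rw [image_fccSlots_eq_units] at hx hy
    exact inner_mem_of_unit_slots A hx.1 hy.1 hx.2 hy.2
  -- the menu trick: an upper pattern vector and a twinned upper pattern vector are not both slots
  have excl : ∀ x y : EuclideanSpace ℝ (Fin 3), x ∈ A '' (↑fccSlots : Set (EuclideanSpace ℝ (Fin 3))) →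
      y ∈ A '' (↑fccSlots : Set (EuclideanSpace ℝ (Fin 3))) →
      ∀ p ∈ fccKissingPattern, 0 < p 0 + p 1 + p 2 → x = B p →
      ∀ q ∈ fccKissingPattern, 0 < q 0 + q 1 + q 2 → y = B (R q) → False := by
    intro x y hx hy p hp hsp hxp q hq hsq hyq
    have hin : ⟪x, y⟫_ℝ = ⟪p, R q⟫_ℝ := by rw [hxp, hyq, LinearIsometry.inner_map_map]
    have h' := menu x y hx hy
    rw [hin] at h'
    rcases inner_fcc_twinRefl_of_pos hp hq hsp hsq with h | h <;>
      rcases h' with h' | h' | h' | h' | h' <;> linarith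
  -- every vector of the hcp dozen is `B p` (`p` non-negative) or `B (R q)` (`q` positive)
  have typ : ∀ x : EuclideanSpace ℝ (Fin 3), x ∈ B '' (↑hcpKissingPattern : Set (EuclideanSpace ℝ (Fin 3))) →
      (∃ p ∈ fccKissingPattern, 0 ≤ p 0 + p 1 + p 2 ∧ x = B p) ∨
      (∃ q ∈ fccKissingPattern, 0 < q 0 + q 1 + q 2 ∧ x = B (R q)) := by
    rintro x ⟨u, hu, rfl⟩
    rcases mem_hcp_cases (Finset.mem_coe.1 hu) with ⟨huf, hs⟩ | ⟨q, hq, hs, rfl⟩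
    · exact Or.inl ⟨u, huf, hs, rfl⟩
    · exact Or.inr ⟨q, hq, hs, rfl⟩
  by_cases hpos : ∃ x : EuclideanSpace ℝ (Fin 3), (x = a ∨ x = b ∨ x = c) ∧
      ∃ p ∈ fccKissingPattern, 0 < p 0 + p 1 + p 2 ∧ x = B p
  · -- case `+`: all three shared vectors lie in the fcc dozen `B(fccKissingPattern)`
    obtain ⟨x₀, hx₀, p₀, hp₀, hs₀, hx₀p⟩ := hpos
    have hx₀A : x₀ ∈ A '' (↑fccSlots : Set (EuclideanSpace ℝ (Fin 3))) := by
      rcases hx₀ with rfl | rfl | rfl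
      exacts [haA, hbA, hcA]
    have toF : ∀ y : EuclideanSpace ℝ (Fin 3), y ∈ B '' (↑hcpKissingPattern : Set (EuclideanSpace ℝ (Fin 3))) →
        y ∈ A '' (↑fccSlots : Set (EuclideanSpace ℝ (Fin 3))) →
        y ∈ B '' (↑fccKissingPattern : Set (EuclideanSpace ℝ (Fin 3))) := by
      intro y hyB hyA
      rcases typ y hyB with ⟨p, hp, -, rfl⟩ | ⟨q, hq, hsq, hyq⟩
      · exact ⟨p, hp, rfl⟩
      · exact (excl x₀ y hx₀A hyA p₀ hp₀ hs₀ hx₀p q hq hsq hyq).elim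
    exact hcpDozen_eq_twin_of_fccDozen_eq A B
      (fccDozen_eq_slots_of_three_independent A B (toF a haB haA) (toF b hbB hbA) (toF c hcB hcA)
        haA hbA hcA hind)
  · -- case `−`: all three shared vectors lie in the fcc dozen of `B' = B ∘ R`
    have toF' : ∀ y : EuclideanSpace ℝ (Fin 3), (y = a ∨ y = b ∨ y = c) →
        y ∈ B '' (↑hcpKissingPattern : Set (EuclideanSpace ℝ (Fin 3))) →
        y ∈ B' '' (↑fccKissingPattern : Set (EuclideanSpace ℝ (Fin 3))) := by
      intro y hy hyB
      rcases typ y hyB with ⟨p, hp, hsp, rfl⟩ | ⟨q, hq, -, rfl⟩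
      · have hs0 : p 0 + p 1 + p 2 = 0 := by
          by_contra hne
          exact hpos ⟨_, hy, p, hp, lt_of_le_of_ne hsp (Ne.symm hne), rfl⟩
        refine ⟨p, hp, ?_⟩
        rw [hB']
        show B (R p) = B p
        rw [show R p = p from twinRefl_of_sum_eq_zero hs0]
      · exact ⟨q, hq, rfl⟩
    obtain ⟨n, hn1, hmenu, hdoz⟩ := hcpDozen_eq_twin_of_fccDozen_eq A B'
      (fccDozen_eq_slots_of_three_independent A B' (toF' a (Or.inl rfl) haB)
        (toF' b (Or.inr (Or.inl rfl)) hbB) (toF' c (Or.inr (Or.inr rfl)) hcB) haA hbA hcA hind)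
    refine ⟨n, hn1, hmenu, ?_⟩
    rw [← hdoz]
    calc B '' (↑hcpKissingPattern : Set (EuclideanSpace ℝ (Fin 3)))
        = B '' (R '' (↑hcpKissingPattern : Set (EuclideanSpace ℝ (Fin 3)))) := by
          rw [twinRefl_image_hcp]
      _ = B' '' (↑hcpKissingPattern : Set (EuclideanSpace ℝ (Fin 3))) := by
          rw [Set.image_image]; rfl

/-- **The own part of a twin dozen is «hexagon + one polar triple».**  Under the hypotheses of
`hcpDozen_twin_of_three_independent`, with the normal `n` it provides: a slot `A w` lies in the hcp dozen
iff `⟪A w, n⟫ ≤ 0`. -/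
theorem slot_mem_twinDozen_iff
    (A : EuclideanSpace ℝ (Fin 3) ≃ₗᵢ[ℝ] EuclideanSpace ℝ (Fin 3)) {n : EuclideanSpace ℝ (Fin 3)}
    (hn : ‖n‖ = 1)
    (hmenu : ∀ w ∈ fccSlots, ⟪A w, n⟫_ℝ = 0 ∨ ⟪A w, n⟫_ℝ = Real.sqrt (2 / 3) ∨ ⟪A w, n⟫_ℝ = -Real.sqrt (2 / 3))
    {D : Set (EuclideanSpace ℝ (Fin 3))}
    (hD : D = (fun w => A w) '' {w | w ∈ fccSlots ∧ ⟪A w, n⟫_ℝ ≤ 0} ∪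
          (fun w => A w - (2 * ⟪A w, n⟫_ℝ) • n) '' {w | w ∈ fccSlots ∧ ⟪A w, n⟫_ℝ < 0})
    {w : EuclideanSpace ℝ (Fin 3)} (hw : w ∈ fccSlots) :
    A w ∈ D ↔ ⟪A w, n⟫_ℝ ≤ 0 := by
  constructor
  · rw [hD]
    rintro (⟨w', ⟨hw', hle⟩, he⟩ | ⟨w', ⟨hw', hlt⟩, he⟩)
    · have : w' = w := A.injective he
      rw [← this]; exact hle
    · -- a mirror image `A w' − 2⟪A w', n⟫ n` with `⟪A w', n⟫ = −√(2/3)` has `⟪·, n⟫ = +√(2/3)`;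
      -- if it equals the slot `A w` then `⟪A w, n⟫ = √(2/3) > 0`… but then `A w − A w' = −2⟪A w',n⟫ n`
      -- has norm `2√(2/3) > 1`… we only need: `⟪A w, n⟫ ≤ 0` fails ⇒ derive a contradiction from norms.
      exfalso
      have hin' : ⟪A w', n⟫_ℝ = -Real.sqrt (2 / 3) := by
        rcases hmenu w' hw' with h | h | h
        · rw [h] at hlt; exact absurd hlt (lt_irrefl 0)
        · rw [h] at hlt; exact absurd hlt (not_lt.2 (Real.sqrt_nonneg _))
        · exact h
      -- `A w = A w' + 2√(2/3) n`, so `⟪A w, A w'⟫ = 1 + 2√(2/3)⟪n, A w'⟫ = 1 − 4/3 = −1/3`: not a slot angle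
      have hnn : ⟪n, n⟫_ℝ = 1 := by rw [real_inner_self_eq_norm_sq, hn, one_pow]
      have hw'1 : ⟪A w', A w'⟫_ℝ = 1 := by
        rw [real_inner_self_eq_norm_sq, LinearIsometryEquiv.norm_map, norm_eq_one_of_mem_fccSlots hw', one_pow]
      have h23 : Real.sqrt (2 / 3) ^ 2 = 2 / 3 := Real.sq_sqrt (by norm_num)
      have hinner : ⟪A w, A w'⟫_ℝ = -(1 / 3) := by
        rw [← he, inner_sub_left, real_inner_smul_left, hw'1, real_inner_comm (A w') n, hin']
        nlinarith [h23]
      have hmenu2 := inner_mem_of_unit_slots A ⟨w, mem_fcc_of_mem_fccSlots hw, rfl⟩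
        ⟨w', mem_fcc_of_mem_fccSlots hw', rfl⟩
        (by rw [LinearIsometryEquiv.norm_map, norm_eq_one_of_mem_fccSlots hw])
        (by rw [LinearIsometryEquiv.norm_map, norm_eq_one_of_mem_fccSlots hw'])
      rcases hmenu2 with h | h | h | h | h <;> linarith
  · intro hle
    rw [hD]
    exact Or.inl ⟨w, ⟨hw, hle⟩, rfl⟩


end Summit.Ventures.Crystal3D.Theorems

end
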